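import Summits.QuantumFields.BalabanUV.T4Continuum.Support.VariationalColourScalarPairClosed
import Summits.QuantumFields.BalabanUV.T4Continuum.Support.VariationalColourTower
import Summits.QuantumFields.BalabanUV.T4Continuum.Support.VariationalEffectiveHilbertPairs
import Summits.QuantumFields.BalabanUV.T4Continuum.Support.VariationalVectorEndClass

/-!
# T⁴ programme, spine node NE2 (U1a), lane P2 — SUPPLIER ITEM «V-COL-END (0-FORMS)»: THE COLOUR 0-FORM SPECIES' η-RATE WITH EVERY LEAF
# DISCHARGED — `colour_pair_closed` per level `n = L^k` + COMP⁺-colour + D-E `towerLimitRate_effC` ⟹ the colour effective operators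
# `effC (L^k) M (Rc k) (T k) b a` CONVERGE at rate `L⁻¹` on `Tor M × κ` under per-level DATA and CLASS hypotheses only
# (the colour twin of the scalar road's tower law `VariationalCovariantTower(Law)` p213109 ∕ p213485; model level; cell `pub-balaban`)

NE2 formalisation swarm `b2b-balaban-t4-ne2-formalise-*`, leaf prover 02 (gen 5); register P2-sup (INTENT CLAIMS.log l.15967; follows «V-COL-CLOSED» 4∕4).
COMPOSITION ONLY, of tree theorems BY NAME: `VariationalColourScalarPairClosed.colour_pair_closed` (p222739; the brackets, all five leaves inside),
leaf-02-g4's COMP⁺-colour `VariationalColourTower.{compTv, Rtrv, Qcv_comp_Qcv_apply, dirUv_transport, sum_norm_sq_transport}` (p215185) and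
P⁺-colour `VariationalColourPoincarePhys.qWv_le_coarse_local` (p216531), D-E `VariationalEffectiveHilbertPairs.towerLimitRate_effC` (p220569; the
pair-to-rate currency on the flattened unit index), leaf-10-g3's defect shapes and level bounds `VariationalVectorEndOfLeaves.{eV, ePV, eV_level_le,
ePV_level_le, levelV_facts}` (p220074 ∕ p222241), `VariationalTower.blockSpin_equiv`.
 * §1 TRANSPORT (colour twins of `VariationalCovariantTower` §3): `Sfv_eq_transport`, `Qkv_comp_Q1v_apply`, **`blockSpin_colour_pair_transport`**
   (`blockSpin (Qkv n M T ∘ Q1v n L M T′) (Sfv n L M R′) μ = blockSpin (Qkv (n·L) M (compTv T T′)) (Scv (n·L) M (Rtrv R′)) μ`), `colour_bracket_transport`;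
 * §2 **`towerLimitRate_colourTower_of_pairs`**: per-level brackets in `colour_pair_bracket`'s conclusion shape (defects `e k, e′ k ≤ C·ρ^k`) + the
   COMP DATA identities `T (k+1) = compTv (T k) (T′ k)`, `Rc (k+1) = Rtrv (R′ k)` (`L^(k+1) = L^k·L` by `rfl`) + UNITARY `T k` + P⁺-colour's binder ⟹
   `TowerLimitRate (fun _ ↦ 1) 1 (k ↦ effC (L^k) M (Rc k) (T k) b a) C ρ`;
 * §3 level bookkeeping (`Λc_k ≤ Λc⋆`, `C_R,k ≤ C_R⋆`, `Λ_k ≤ Λ⋆`, `ε₁,k ≤ c_ε θ^k`, `δ′_k ≤ c_δ′ θ^k`, `δ_k ≤ c_δ θ^k` at `θ = L⁻¹` under the classes) and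
   **`towerLimitRate_colourTower_closed`**: per level EXACTLY `colour_pair_closed`'s DATA hypotheses + the CLASS lines `L^k·w_k ≤ c_w`,
   `a_k·(L^k)² ≤ c_a`, `(L^k)²·m_k ≤ c_m`, `(L^k)²·m₁,k ≤ c₁` and `2 ≤ L` ⟹ the rate `L⁻¹` with the explicit constant
   `eV Λ⋆ 136 (√d·c_m) + ePV Λ⋆ 136 C_R⋆ ((d∕4+½)L) (√(2d(1+d²))·L·c₁)` — NO leaf displayed, NO NE3.

HONEST FRAMING (T4-DAG p. 1).  MODEL LEVEL: operators `Rc k, R′ k, T k, T′ k`, their defects and the COMP identities are DATA (no identification with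
Bałaban's `U(Γ)` ∕ taxi transports — c5, no B0; whether Bałaban's actual data inhabit the classes is the taxi-tower business of leaf-04's lineage and the
scalar road's composition caveats N-ne2p2g11-2 ∕ G-ne2leaf04g2-1 apply verbatim).  [folklore] plumbing + real arithmetic; nothing printed is a
hypothesis; no `def`; no `sorry`; axioms standard.  NE2 NOT proved; NE3 untouched; spine PROVED 0∕9; rung (B)+1 finite T⁴ — NOT infinite volume, NOT a
mass gap, NOT Clay.  HONEST DEPENDENCY (cell, verbatim): continuum YM on T⁴ ⇐ BetaPertH ∧ nine spine estimates (0/9 proved); BetaPertH ⇐ (D1) ∧ (D4) ∧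
CAP+tail; G-an2-4 gates asym, D1 and NE2/3/4.
-/

noncomputable section

namespace Summit.QuantumFields.BalabanUV.T4Continuum.VariationalColourTowerEnd

open Finset
open scoped Matrix
open Literature.MathematicalPhysics.QuantumFieldTheory.Balaban1983to89
open Literature.MathematicalPhysics.QuantumFieldTheory.Balaban1983to89.B5Prop11Plancherel (Tor fine unitVec)
open Literature.MathematicalPhysics.QuantumFieldTheory.Balaban1983to89.B5Block118 (bpt)
open Literature.MathematicalPhysics.QuantumFieldTheory.Balaban1983to89.B5Blocks16 (blockOf)
open Literature.MathematicalPhysics.QuantumFieldTheory.Balaban1983to89.B5Composition116 (sites)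
open Summit.QuantumFields.BalabanUV.T4Continuum.VariationalTransfer (blockSpin)
open Summit.QuantumFields.BalabanUV.T4Continuum.VariationalTower (blockSpin_equiv)
open Summit.QuantumFields.BalabanUV.T4Continuum.CovariantAveragingTower (TowerLimitRate)
open Summit.QuantumFields.BalabanUV.T4Continuum.VariationalColourFederbush (dirUv misv Qcv norm_le_one_of_mem_unitary)
open Summit.QuantumFields.BalabanUV.T4Continuum.VariationalColourUpperBound (nsqv nsqv_nonneg)
open Summit.QuantumFields.BalabanUV.T4Continuum.VariationalColourScalarPair (Scv Sfv qWv qVv Qkv Q1v apply_star_apply)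
open Summit.QuantumFields.BalabanUV.T4Continuum.VariationalColourTower (compTv Rtrv Qcv_comp_Qcv_apply dirUv_transport sum_norm_sq_transport)
open Summit.QuantumFields.BalabanUV.T4Continuum.VariationalColourPoincarePhys (qWv_le_coarse_local)
open Summit.QuantumFields.BalabanUV.T4Continuum.VariationalColourScalarPairClosed (colour_pair_closed)
open Summit.QuantumFields.BalabanUV.T4Continuum.VariationalEffectiveHilbertPairs (effC towerLimitRate_effC)
open Summit.QuantumFields.BalabanUV.T4Continuum.VariationalVectorEndOfLeaves (eV ePV eV_nonneg ePV_nonneg eV_level_le ePV_level_le levelV_facts)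

variable {d : ℕ} {E : Type*} [NormedAddCommGroup E] [InnerProductSpace ℂ E] [CompleteSpace E]

/-! ## §1 Transport of the fine member of the colour pair to the level-`n·L` coarse presentation -/

section Transport

variable (n L : ℕ) [NeZero n] [NeZero L] (M : Fin d → ℕ) [hM : ∀ μ, NeZero (M μ)]

omit [CompleteSpace E] in
/-- the fine colour form IS the level-`n·L` coarse colour form on the transported data: `Sfv n L M R′ f′ = Scv (n·L) M (Rtrv R′) (f′ ∘ sites)`. [folklore] -/
theorem Sfv_eq_transport (R' : Tor (fine L (fine n M)) → Fin d → (E →L[ℂ] E)) (f' : Tor (fine L (fine n M)) → E) :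
    Sfv n L M R' f' = Scv (n * L) M (Rtrv n L M R') (f' ∘ sites n L M) := by
  unfold Sfv Scv
  simp_rw [dirUv_transport]
  push_cast
  rfl

omit [InnerProductSpace ℂ E] [CompleteSpace E] in
/-- the fine size IS the level-`n·L` coarse size on the transported field. [folklore] -/
theorem qVv_eq_transport [NormedSpace ℂ E] (f' : Tor (fine L (fine n M)) → E) : qVv n L M f' = qWv (n * L) M (f' ∘ sites n L M) := by
  unfold qVv qWv nsqv
  rw [sum_norm_sq_transport]
  push_cast
  rfl

omit [CompleteSpace E] in
/-- COMP⁺ in the pair's letters: `Qkv T (Q1v T′ f′) = Qkv_{n·L} (compTv T T′) (f′ ∘ sites)`. [folklore] -/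
theorem Qkv_comp_Q1v_apply (T : Tor (fine n M) → (E →L[ℂ] E)) (T' : Tor (fine L (fine n M)) → (E →L[ℂ] E)) (f' : Tor (fine L (fine n M)) → E) :
    Qkv n M T (Q1v n L M T' f') = Qkv (n * L) M (compTv n L M T T') (f' ∘ sites n L M) :=
  Qcv_comp_Qcv_apply n L M T T' f'

omit [CompleteSpace E] in
/-- **`blockSpin (Q_T ∘ Q_{T′}) Sfv = blockSpin Q_{T″} Scv_{n·L}` on the transported data** (`VariationalTower.blockSpin_equiv` along `f′ ↦ f′ ∘ sites`).
[folklore] -/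
theorem blockSpin_colour_pair_transport (T : Tor (fine n M) → (E →L[ℂ] E)) (T' : Tor (fine L (fine n M)) → (E →L[ℂ] E))
    (R' : Tor (fine L (fine n M)) → Fin d → (E →L[ℂ] E)) (μ : Tor M → E) :
    blockSpin (Qkv n M T ∘ Q1v n L M T') (Sfv n L M R') μ
      = blockSpin (Qkv (n * L) M (compTv n L M T T')) (Scv (n * L) M (Rtrv n L M R')) μ := by
  symm
  refine blockSpin_equiv ((sites n L M).symm.arrowCongr (Equiv.refl E)) (fun f' => ?_) (fun f' => ?_) μ
  · have harr : (sites n L M).symm.arrowCongr (Equiv.refl E) f' = f' ∘ sites n L M := by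
      funext x; simp [Equiv.arrowCongr_apply]
    rw [harr]
    exact (Qkv_comp_Q1v_apply n L M T T' f').symm
  · have harr : (sites n L M).symm.arrowCongr (Equiv.refl E) f' = f' ∘ sites n L M := by
      funext x; simp [Equiv.arrowCongr_apply]
    rw [harr, Sfv_eq_transport]

omit [CompleteSpace E] in
/-- the colour canonical-pair bracket in the level-`n·L` coarse presentation. [folklore] -/
theorem colour_bracket_transport {Rc : Tor (fine n M) → Fin d → (E →L[ℂ] E)} {R' : Tor (fine L (fine n M)) → Fin d → (E →L[ℂ] E)}
    {T : Tor (fine n M) → (E →L[ℂ] E)} {T' : Tor (fine L (fine n M)) → (E →L[ℂ] E)} {e e' : ℝ} {μ : Tor M → E}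
    (hbr : blockSpin (Qkv n M T) (Scv n M Rc) μ ≤ blockSpin (Qkv n M T ∘ Q1v n L M T') (Sfv n L M R') μ + e * nsqv μ ∧
      blockSpin (Qkv n M T ∘ Q1v n L M T') (Sfv n L M R') μ ≤ blockSpin (Qkv n M T) (Scv n M Rc) μ + e' * nsqv μ) :
    blockSpin (Qkv n M T) (Scv n M Rc) μ ≤ blockSpin (Qkv (n * L) M (compTv n L M T T')) (Scv (n * L) M (Rtrv n L M R')) μ + e * nsqv μ ∧
      blockSpin (Qkv (n * L) M (compTv n L M T T')) (Scv (n * L) M (Rtrv n L M R')) μ ≤ blockSpin (Qkv n M T) (Scv n M Rc) μ + e' * nsqv μ := by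
  rw [← blockSpin_colour_pair_transport]; exact hbr

end Transport

/-! ## §2 The colour tower from per-level pair brackets -/

section Tower

variable (L : ℕ) [NeZero L] (M : Fin d → ℕ) [hM : ∀ μ, NeZero (M μ)] {κ : Type*} [Fintype κ] [DecidableEq κ]
variable (Rc : (k : ℕ) → Tor (fine (L ^ k) M) → Fin d → (E →L[ℂ] E)) (T : (k : ℕ) → Tor (fine (L ^ k) M) → (E →L[ℂ] E))
variable (R' : (k : ℕ) → Tor (fine L (fine (L ^ k) M)) → Fin d → (E →L[ℂ] E)) (T' : (k : ℕ) → Tor (fine L (fine (L ^ k) M)) → (E →L[ℂ] E))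

/-- **THE COLOUR TOWER FROM THE PAIR BRACKETS**: UNITARY site operators `T k`, P⁺-colour's binder per level, the COMP DATA identities, and per-level
brackets in `colour_pair_bracket`'s conclusion shape with defects `e k, e′ k ≤ C·ρ^k` (`0 ≤ ρ < 1`) ⟹
`TowerLimitRate (fun _ ↦ 1) 1 (k ↦ effC (L^k) M (Rc k) (T k) b a) C ρ` on `Tor M × κ`.  Nothing of NE3. [folklore] -/
theorem towerLimitRate_colourTower_of_pairs [FiniteDimensional ℂ E] (hT : ∀ k x, T k x ∈ unitary (E →L[ℂ] E)) {CP : ℕ → ℝ}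
    (hPc : ∀ k f, qWv (L ^ k) M f ≤ CP k * (Scv (L ^ k) M (Rc k) f + nsqv (Qkv (L ^ k) M (T k) f)))
    (hTcomp : ∀ k, T (k + 1) = compTv (L ^ k) L M (T k) (T' k)) (hRtr : ∀ k, Rc (k + 1) = Rtrv (L ^ k) L M (R' k))
    (b : OrthonormalBasis κ ℂ E) {a : ℝ} (ha : 0 < a) {C ρ : ℝ} (hC : 0 ≤ C) (hρ : 0 ≤ ρ) (hρ1 : ρ < 1) (e e' : ℕ → ℝ)
    (he : ∀ k, e k ≤ C * ρ ^ k) (he' : ∀ k, e' k ≤ C * ρ ^ k)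
    (hbr : ∀ k (μ : Tor M → E),
      blockSpin (Qkv (L ^ k) M (T k)) (Scv (L ^ k) M (Rc k)) μ
          ≤ blockSpin (Qkv (L ^ k) M (T k) ∘ Q1v (L ^ k) L M (T' k)) (Sfv (L ^ k) L M (R' k)) μ + e k * nsqv μ ∧
        blockSpin (Qkv (L ^ k) M (T k) ∘ Q1v (L ^ k) L M (T' k)) (Sfv (L ^ k) L M (R' k)) μ
          ≤ blockSpin (Qkv (L ^ k) M (T k)) (Scv (L ^ k) M (Rc k)) μ + e' k * nsqv μ) :
    TowerLimitRate (ι := fun _ => Tor M × κ) (fun _ => (1 : Matrix (Tor M × κ) (Tor M × κ) ℂ)) 1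
      (fun k => effC (L ^ k) M (Rc k) (T k) b a) C ρ := by
  refine towerLimitRate_effC L M Rc T (fun k x => star (T k x)) (fun k x v => apply_star_apply (hT k x) v) hPc b ha hC hρ hρ1 e e' he he'
    fun k μ => ?_
  have hlev : blockSpin (Qkv (L ^ (k + 1)) M (T (k + 1))) (Scv (L ^ (k + 1)) M (Rc (k + 1))) μ
      = blockSpin (Qkv (L ^ k * L) M (compTv (L ^ k) L M (T k) (T' k))) (Scv (L ^ k * L) M (Rtrv (L ^ k) L M (R' k))) μ := by
    rw [hTcomp k, hRtr k]; rfl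
  rw [hlev]
  exact colour_bracket_transport (L ^ k) L M (hbr k μ)

end Tower

/-! ## §3 Level bookkeeping under the classes, and the closed colour tower -/

section Levels

variable (L : ℕ)

/-- the FED⁺ parameter decays: `n²·m ≤ c_m` ⟹ `√d·(n·m) ≤ √d·c_m·(L⁻¹)^k` at `n = L^k`. [folklore] -/
theorem delta_level_le (hL1 : (1 : ℝ) ≤ L) (k : ℕ) {m cm : ℝ} (hcm : (((L ^ k : ℕ)) : ℝ) ^ 2 * m ≤ cm) :
    Real.sqrt d * ((((L ^ k : ℕ)) : ℝ) * m) ≤ Real.sqrt d * cm * ((L : ℝ)⁻¹) ^ k := by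
  obtain ⟨hn1, hninv, hn0⟩ := levelV_facts L hL1 k
  set n : ℝ := (((L ^ k : ℕ)) : ℝ)
  rw [← hninv, mul_assoc]
  refine mul_le_mul_of_nonneg_left ?_ (Real.sqrt_nonneg _)
  rw [← div_eq_mul_inv, le_div_iff₀ hn0]
  nlinarith

/-- the ONE⁺ parameter `ε₁ = (d∕4 + ½)·L∕n²` decays: `≤ (d∕4 + ½)·L·(L⁻¹)^k`. [folklore] -/
theorem eps1_level_le (hL1 : (1 : ℝ) ≤ L) (k : ℕ) :
    ((d : ℝ) / 4 + 1 / 2) * ((L : ℝ) / (((L ^ k : ℕ)) : ℝ) ^ 2) ≤ ((d : ℝ) / 4 + 1 / 2) * L * ((L : ℝ)⁻¹) ^ k := by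
  obtain ⟨hn1, hninv, hn0⟩ := levelV_facts L hL1 k
  set n : ℝ := (((L ^ k : ℕ)) : ℝ)
  rw [← hninv, mul_assoc]
  refine mul_le_mul_of_nonneg_left ?_ (by positivity)
  rw [div_eq_mul_inv]
  refine mul_le_mul_of_nonneg_left ?_ (by linarith)
  rw [inv_le_inv₀ (by positivity) hn0]
  nlinarith

/-- the ONE⁺ parameter `δ′ = √(2d(1+d²))·(n·L·m₁)` decays: `n²·m₁ ≤ c₁` ⟹ `δ′ ≤ √(2d(1+d²))·(L·c₁)·(L⁻¹)^k`. [folklore] -/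
theorem deltaP_level_le (hL1 : (1 : ℝ) ≤ L) (k : ℕ) {m₁ c₁ : ℝ} (hc₁ : (((L ^ k : ℕ)) : ℝ) ^ 2 * m₁ ≤ c₁) :
    Real.sqrt (2 * d * (1 + (d : ℝ) ^ 2)) * ((((L ^ k : ℕ)) : ℝ) * L * m₁)
      ≤ Real.sqrt (2 * d * (1 + (d : ℝ) ^ 2)) * ((L : ℝ) * c₁) * ((L : ℝ)⁻¹) ^ k := by
  obtain ⟨hn1, hninv, hn0⟩ := levelV_facts L hL1 k
  set n : ℝ := (((L ^ k : ℕ)) : ℝ)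
  have hL0 : (0 : ℝ) ≤ L := by linarith
  rw [← hninv, mul_assoc (Real.sqrt _)]
  refine mul_le_mul_of_nonneg_left ?_ (Real.sqrt_nonneg _)
  rw [← div_eq_mul_inv, le_div_iff₀ hn0]
  nlinarith [mul_le_mul_of_nonneg_left hc₁ hL0]

/-- the UB⁺ constant is bounded under the in-block class: `0 ≤ n·w ≤ c_w` ⟹ `2d·36^d((1+nw)²+9) ≤ 2d·36^d((1+c_w)²+9)`. [folklore] -/
theorem Lamc_level_le {x cw : ℝ} (hx : 0 ≤ x) (hxc : x ≤ cw) :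
    2 * (d : ℝ) * (36 : ℝ) ^ d * ((1 + x) ^ 2 + 9) ≤ 2 * (d : ℝ) * (36 : ℝ) ^ d * ((1 + cw) ^ 2 + 9) := by
  have h : (1 + x) ^ 2 ≤ (1 + cw) ^ 2 := by nlinarith
  have h0 : (0 : ℝ) ≤ 2 * (d : ℝ) * (36 : ℝ) ^ d := by positivity
  nlinarith

/-- the REG⁺ constant is bounded under the in-block and plaquette classes. [folklore] -/
theorem CR_level_le {Λc Λcs α ca : ℝ} (hΛc : Λc ≤ Λcs) (hα : 0 ≤ α) (hαc : α ≤ ca) :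
    2 * Λc + 2 * (d : ℝ) * α + (d : ℝ) ^ 2 * α ^ 2 * 136 ≤ 2 * Λcs + 2 * (d : ℝ) * ca + (d : ℝ) ^ 2 * ca ^ 2 * 136 := by
  have hd : (0 : ℝ) ≤ d := Nat.cast_nonneg d
  have h1 : α ^ 2 ≤ ca ^ 2 := by nlinarith
  nlinarith [mul_nonneg hd hα, sq_nonneg (d : ℝ)]

/-- the common UB⁺ constant `Λ = Λc + (ε₁C_R + 2δ′√((1+ε₁C_R)·136) + δ′²·136)(Λc+1)` is monotone in `(Λc, C_R, ε₁, δ′)` on the nonnegative cone.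
[folklore] -/
theorem Lam_level_le {Λc Λcs CR CRs ε₁ cε δ' cδ' : ℝ} (hΛc0 : 0 ≤ Λc) (hΛc : Λc ≤ Λcs) (hCR0 : 0 ≤ CR) (hCR : CR ≤ CRs)
    (hε0 : 0 ≤ ε₁) (hε : ε₁ ≤ cε) (hδ0 : 0 ≤ δ') (hδ : δ' ≤ cδ') :
    Λc + (ε₁ * CR + 2 * δ' * Real.sqrt ((1 + ε₁ * CR) * 136) + δ' ^ 2 * 136) * (Λc + 1)
      ≤ Λcs + (cε * CRs + 2 * cδ' * Real.sqrt ((1 + cε * CRs) * 136) + cδ' ^ 2 * 136) * (Λcs + 1) := by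
  have h1 : ε₁ * CR ≤ cε * CRs := mul_le_mul hε hCR hCR0 (hε0.trans hε)
  have h2 : Real.sqrt ((1 + ε₁ * CR) * 136) ≤ Real.sqrt ((1 + cε * CRs) * 136) :=
    Real.sqrt_le_sqrt (by nlinarith)
  have h3 : 2 * δ' * Real.sqrt ((1 + ε₁ * CR) * 136) ≤ 2 * cδ' * Real.sqrt ((1 + cε * CRs) * 136) :=
    mul_le_mul (by linarith) h2 (Real.sqrt_nonneg _) (by linarith [hδ0.trans hδ])
  have h4 : δ' ^ 2 * 136 ≤ cδ' ^ 2 * 136 := by nlinarith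
  have hA0 : 0 ≤ ε₁ * CR + 2 * δ' * Real.sqrt ((1 + ε₁ * CR) * 136) + δ' ^ 2 * 136 := by positivity
  have hA : ε₁ * CR + 2 * δ' * Real.sqrt ((1 + ε₁ * CR) * 136) + δ' ^ 2 * 136
      ≤ cε * CRs + 2 * cδ' * Real.sqrt ((1 + cε * CRs) * 136) + cδ' ^ 2 * 136 := by linarith
  have hB : (ε₁ * CR + 2 * δ' * Real.sqrt ((1 + ε₁ * CR) * 136) + δ' ^ 2 * 136) * (Λc + 1)
      ≤ (cε * CRs + 2 * cδ' * Real.sqrt ((1 + cε * CRs) * 136) + cδ' ^ 2 * 136) * (Λcs + 1) :=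
    mul_le_mul hA (by linarith) (by linarith) (hA0.trans hA)
  linarith

end Levels

section Closed

variable (L : ℕ) [NeZero L] (M : Fin d → ℕ) [hM : ∀ μ, NeZero (M μ)] {κ : Type*} [Fintype κ] [DecidableEq κ]
variable (Rc : (k : ℕ) → Tor (fine (L ^ k) M) → Fin d → (E →L[ℂ] E)) (T : (k : ℕ) → Tor (fine (L ^ k) M) → (E →L[ℂ] E))
variable (R' : (k : ℕ) → Tor (fine L (fine (L ^ k) M)) → Fin d → (E →L[ℂ] E)) (T' : (k : ℕ) → Tor (fine L (fine (L ^ k) M)) → (E →L[ℂ] E))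

/-- **THE COLOUR 0-FORM TOWER, CLOSED — EVERY LEAF DISCHARGED.**  DATA per level `k` (`n = L^k`): UNITARY `Rc k` (plaquette defect `p k`, in-block defect
`w k` against UNITARY `T k`), contractive `R′ k` (in-block defect `w′ k` against UNITARY `T′ k`), one-step defects `m₁ k`, one-block mismatch `m k`, the three
local absorptions, the COMP identities; CLASSES `n·w k ≤ c_w`, `p k·n² ≤ c_p`, `n²·m k ≤ c_m`, `n²·m₁ k ≤ c₁`, `2 ≤ L`.  THEN the colour effective operators
`effC (L^k) M (Rc k) (T k) b a` (D-E, p220569) satisfy `TowerLimitRate (fun _ ↦ 1) 1 (k ↦ X_k) C L⁻¹`, i.e. CONVERGE on `Tor M × κ` with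
`‖X_k − X_∞‖ ≤ C·L^{−k}∕(1 − L⁻¹)`, `C = eV Λ⋆ 136 (√d·c_m) + ePV Λ⋆ 136 C_R⋆ ((d∕4+½)L) (√(2d(1+d²))·(L·c₁))`.  NO leaf displayed; NO NE3. [folklore] -/
theorem towerLimitRate_colourTower_closed [FiniteDimensional ℂ E] (hL : 2 ≤ L)
    (hTcomp : ∀ k, T (k + 1) = compTv (L ^ k) L M (T k) (T' k)) (hRtr : ∀ k, Rc (k + 1) = Rtrv (L ^ k) L M (R' k))
    -- level-`k` coarse data
    (hT : ∀ k x, T k x ∈ unitary (E →L[ℂ] E)) (hRc : ∀ k x μ, Rc k x μ ∈ unitary (E →L[ℂ] E)) (w : ℕ → ℝ) (hw0 : ∀ k, 0 ≤ w k)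
    (hw : ∀ k (x : Tor (fine (L ^ k) M)) (μ : Fin d), blockOf (L ^ k) M (x + unitVec (fine (L ^ k) M) μ) = blockOf (L ^ k) M x →
      ‖Rc k x μ * star (T k (x + unitVec (fine (L ^ k) M) μ)) * T k x - 1‖ ≤ w k)
    (hsmall : ∀ k, 2 * (d : ℝ) * ((((L ^ k : ℕ)) : ℝ) * w k) ^ 2 ≤ 1 / 2)
    (p : ℕ → ℝ) (hp : ∀ k, 0 ≤ p k)
    (hP : ∀ k x μ ν, ‖Rc k x μ * Rc k (x + unitVec (fine (L ^ k) M) μ) ν - Rc k x ν * Rc k (x + unitVec (fine (L ^ k) M) ν) μ‖ ≤ p k)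
    -- level-`k` one-step data
    (hT' : ∀ k x, T' k x ∈ unitary (E →L[ℂ] E)) (hR' : ∀ k x μ, ‖R' k x μ‖ ≤ 1) (w' : ℕ → ℝ)
    (hw' : ∀ k (x : Tor (fine L (fine (L ^ k) M))) (μ : Fin d),
      blockOf L (fine (L ^ k) M) (x + unitVec (fine L (fine (L ^ k) M)) μ) = blockOf L (fine (L ^ k) M) x →
      ‖R' k x μ * star (T' k (x + unitVec (fine L (fine (L ^ k) M)) μ)) * T' k x - 1‖ ≤ w' k)
    (hsmall' : ∀ k, 2 * (d : ℝ) * ((L : ℝ) * w' k) ^ 2 ≤ 1 / 2)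
    (m : ℕ → ℝ) (hm : ∀ k, 0 ≤ m k) (hmis : ∀ k y μ j, ‖misv L (fine (L ^ k) M) (Rc k) (R' k) (T' k) y μ j‖ ≤ m k)
    (habsorb : ∀ k, 64 * (d : ℝ) * ((((L ^ k : ℕ)) : ℝ) * m k) ^ 2 ≤ 1 / 2)
    (m₁ : ℕ → ℝ) (hm₁ : ∀ k, 0 ≤ m₁ k)
    (hin : ∀ k (y : Tor (fine (L ^ k) M)) (j : Fin d → Fin L) (μ : Fin d), (j μ : ℕ) + 1 < L →
      ‖R' k (bpt L (fine (L ^ k) M) y j) μ * star (T' k (bpt L (fine (L ^ k) M) y j + unitVec (fine L (fine (L ^ k) M)) μ))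
        - star (T' k (bpt L (fine (L ^ k) M) y j))‖ ≤ m₁ k)
    (hcross : ∀ k (y : Tor (fine (L ^ k) M)) (j : Fin d → Fin L) (μ : Fin d), (j μ : ℕ) + 1 = L →
      ‖R' k (bpt L (fine (L ^ k) M) y j) μ * star (T' k (bpt L (fine (L ^ k) M) y j + unitVec (fine L (fine (L ^ k) M)) μ))
        - star (T' k (bpt L (fine (L ^ k) M) y j)) * Rc k y μ‖ ≤ m₁ k)
    -- the classes
    {cw cp cm c₁ : ℝ} (hcw : ∀ k, (((L ^ k : ℕ)) : ℝ) * w k ≤ cw) (hcp : ∀ k, p k * (((L ^ k : ℕ)) : ℝ) ^ 2 ≤ cp)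
    (hcm : ∀ k, (((L ^ k : ℕ)) : ℝ) ^ 2 * m k ≤ cm) (hc₁ : ∀ k, (((L ^ k : ℕ)) : ℝ) ^ 2 * m₁ k ≤ c₁)
    (b : OrthonormalBasis κ ℂ E) {a : ℝ} (ha : 0 < a) :
    let Λcs : ℝ := 2 * d * (36 : ℝ) ^ d * ((1 + cw) ^ 2 + 9)
    let CRs : ℝ := 2 * Λcs + 2 * d * cp + (d : ℝ) ^ 2 * cp ^ 2 * 136
    let cε : ℝ := ((d : ℝ) / 4 + 1 / 2) * L
    let cδ' : ℝ := Real.sqrt (2 * d * (1 + (d : ℝ) ^ 2)) * ((L : ℝ) * c₁)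
    let Λs : ℝ := Λcs + (cε * CRs + 2 * cδ' * Real.sqrt ((1 + cε * CRs) * 136) + cδ' ^ 2 * 136) * (Λcs + 1)
    TowerLimitRate (ι := fun _ => Tor M × κ) (fun _ => (1 : Matrix (Tor M × κ) (Tor M × κ) ℂ)) 1
      (fun k => effC (L ^ k) M (Rc k) (T k) b a) (eV Λs 136 (Real.sqrt d * cm) + ePV Λs 136 CRs cε cδ') ((L : ℝ)⁻¹) := by
  intro Λcs CRs cε cδ' Λs
  have hL1 : (1 : ℝ) ≤ L := by exact_mod_cast (show 1 ≤ L by omega)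
  have hL0 : (0 : ℝ) < L := by linarith
  have hθ0 : (0 : ℝ) ≤ (L : ℝ)⁻¹ := by positivity
  have hθ1 : ((L : ℝ)⁻¹) < 1 := inv_lt_one_of_one_lt₀ (by exact_mod_cast (show 1 < L by omega))
  have hθ1' : ((L : ℝ)⁻¹) ≤ 1 := hθ1.le
  have hd : (0 : ℝ) ≤ d := Nat.cast_nonneg d
  -- the level constants of `colour_pair_closed` at `n = L^k`
  let nk : ℕ → ℝ := fun k => (((L ^ k : ℕ)) : ℝ)
  let Λc : ℕ → ℝ := fun k => 2 * d * (36 : ℝ) ^ d * ((1 + nk k * w k) ^ 2 + 9)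
  let CR : ℕ → ℝ := fun k => 2 * Λc k + 2 * d * (p k * nk k ^ 2) + (d : ℝ) ^ 2 * (p k * nk k ^ 2) ^ 2 * 136
  let ε₁ : ℕ → ℝ := fun k => ((d : ℝ) / 4 + 1 / 2) * ((L : ℝ) / nk k ^ 2)
  let δ' : ℕ → ℝ := fun k => Real.sqrt (2 * d * (1 + (d : ℝ) ^ 2)) * (nk k * L * m₁ k)
  let Λ : ℕ → ℝ := fun k => Λc k + (ε₁ k * CR k + 2 * δ' k * Real.sqrt ((1 + ε₁ k * CR k) * 136) + δ' k ^ 2 * 136) * (Λc k + 1)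
  let δ : ℕ → ℝ := fun k => Real.sqrt d * (nk k * m k)
  -- class facts per level
  have hnk0 : ∀ k, 0 ≤ nk k := fun k => by positivity
  have hx : ∀ k, 0 ≤ nk k * w k := fun k => mul_nonneg (hnk0 k) (hw0 k)
  have hcw0 : 0 ≤ cw := (hx 0).trans (hcw 0)
  have hα0 : ∀ k, 0 ≤ p k * nk k ^ 2 := fun k => by have := hp k; positivity
  have hcp0 : 0 ≤ cp := (hα0 0).trans (hcp 0)
  have hΛc0 : ∀ k, 0 ≤ Λc k := fun k => by have := hx k; positivity
  have hΛcs : ∀ k, Λc k ≤ Λcs := fun k => Lamc_level_le (hx k) (hcw k)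
  have hΛcs0 : 0 ≤ Λcs := (hΛc0 0).trans (hΛcs 0)
  have hCR0 : ∀ k, 0 ≤ CR k := fun k => by have := hΛc0 k; have := hα0 k; positivity
  have hCRs : ∀ k, CR k ≤ CRs := fun k => CR_level_le (hΛcs k) (hα0 k) (hcp k)
  have hCRs0 : 0 ≤ CRs := (hCR0 0).trans (hCRs 0)
  have hε0 : ∀ k, 0 ≤ ε₁ k := fun k => by have := hnk0 k; positivity
  have hεθ : ∀ k, ε₁ k ≤ cε * ((L : ℝ)⁻¹) ^ k := fun k => eps1_level_le L hL1 k
  have hcε0 : 0 ≤ cε := by positivity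
  have hε1 : ∀ k, ε₁ k ≤ cε := fun k => (hεθ k).trans (mul_le_of_le_one_right hcε0 (pow_le_one₀ hθ0 hθ1'))
  have hδ'0 : ∀ k, 0 ≤ δ' k := fun k => by have := hnk0 k; have := hm₁ k; positivity
  have hδ'θ : ∀ k, δ' k ≤ cδ' * ((L : ℝ)⁻¹) ^ k := fun k => deltaP_level_le L hL1 k (hc₁ k)
  have hcδ'0 : 0 ≤ cδ' := (hδ'0 0).trans (by simpa using hδ'θ 0)
  have hδ'1 : ∀ k, δ' k ≤ cδ' := fun k => (hδ'θ k).trans (mul_le_of_le_one_right hcδ'0 (pow_le_one₀ hθ0 hθ1'))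
  have hΛ0 : ∀ k, 0 ≤ Λ k := fun k => by
    have := hΛc0 k; have := hCR0 k; have := hε0 k; have := hδ'0 k; positivity
  have hΛs : ∀ k, Λ k ≤ Λs := fun k => Lam_level_le (hΛc0 k) (hΛcs k) (hCR0 k) (hCRs k) (hε0 k) (hε1 k) (hδ'0 k) (hδ'1 k)
  have hδ0 : ∀ k, 0 ≤ δ k := fun k => by have := hnk0 k; have := hm k; positivity
  have hδθ : ∀ k, δ k ≤ Real.sqrt d * cm * ((L : ℝ)⁻¹) ^ k := fun k => delta_level_le L hL1 k (hcm k)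
  have hcm0 : 0 ≤ Real.sqrt d * cm := (hδ0 0).trans (by simpa using hδθ 0)
  -- the per-level defects and their rates
  have hE0 : 0 ≤ eV Λs 136 (Real.sqrt d * cm) := eV_nonneg ((hΛ0 0).trans (hΛs 0)) (by norm_num) hcm0
  have hEP0 : 0 ≤ ePV Λs 136 CRs cε cδ' := ePV_nonneg ((hΛ0 0).trans (hΛs 0)) (by norm_num) hCRs0 hcε0 hcδ'0
  have hC : 0 ≤ eV Λs 136 (Real.sqrt d * cm) + ePV Λs 136 CRs cε cδ' := add_nonneg hE0 hEP0
  have he : ∀ k, eV (Λ k) 136 (δ k) ≤ (eV Λs 136 (Real.sqrt d * cm) + ePV Λs 136 CRs cε cδ') * ((L : ℝ)⁻¹) ^ k := fun k => by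
    have h1 := eV_level_le k (hΛ0 k) (hΛs k) (by norm_num : (0 : ℝ) ≤ 136) le_rfl (hδ0 k) hθ0 hθ1' (hδθ k)
    have h2 : 0 ≤ ePV Λs 136 CRs cε cδ' * ((L : ℝ)⁻¹) ^ k := mul_nonneg hEP0 (pow_nonneg hθ0 k)
    linarith [add_mul (eV Λs 136 (Real.sqrt d * cm)) (ePV Λs 136 CRs cε cδ') (((L : ℝ)⁻¹) ^ k)]
  have he' : ∀ k, ePV (Λ k) 136 (CR k) (ε₁ k) (δ' k) ≤ (eV Λs 136 (Real.sqrt d * cm) + ePV Λs 136 CRs cε cδ') * ((L : ℝ)⁻¹) ^ k := fun k => by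
    have h1 := ePV_level_le k (hΛ0 k) (hΛs k) (by norm_num : (0 : ℝ) ≤ 136) le_rfl (hCR0 k) (hCRs k) (hε0 k) hcε0 (hδ'0 k) hcδ'0
      hθ0 hθ1' (hεθ k) (hδ'θ k)
    have h2 : 0 ≤ eV Λs 136 (Real.sqrt d * cm) * ((L : ℝ)⁻¹) ^ k := mul_nonneg hE0 (pow_nonneg hθ0 k)
    linarith [add_mul (eV Λs 136 (Real.sqrt d * cm)) (ePV Λs 136 CRs cε cδ') (((L : ℝ)⁻¹) ^ k)]
  -- the colour pair, closed, at every level, fed to the pair-to-rate currency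
  refine towerLimitRate_colourTower_of_pairs L M Rc T R' T' hT (CP := fun _ => 136)
    (fun k f => qWv_le_coarse_local (L ^ k) M (hT k) (hw k) (hsmall k) f) hTcomp hRtr b ha hC hθ0 hθ1
    (fun k => eV (Λ k) 136 (δ k)) (fun k => ePV (Λ k) 136 (CR k) (ε₁ k) (δ' k)) he he' fun k μ => ?_
  exact colour_pair_closed (L ^ k) L M (hT k) (hRc k) (hw0 k) (hw k) (hsmall k) (hp k) (hP k) (hT' k) (hR' k) (hw' k) (hsmall' k)
    (hm k) (hmis k) (habsorb k) (hm₁ k) (hin k) (hcross k) μ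

end Closed

end Summit.QuantumFields.BalabanUV.T4Continuum.VariationalColourTowerEnd

end
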